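import Summits.ValiantsHypothesis.ValiantsHypothesis.Theorems.BarrierLeverChowHitsThinRowPartitionMinorsRefutation
import Summits.ValiantsHypothesis.ValiantsHypothesis.Theorems.BarrierLeverChowHitsPartitionMinorsRNoStarGlue
import Summits.ValiantsHypothesis.ValiantsHypothesis.Theorems.BarrierLeverChowHitsPartitionMinorsRBiStar

/-!
# Route BarrierLever — item `ChowHitsPartitionMinorsR` (stmt-ValiantsHypothesis-21882):
# STARVED PAIRS — the thin-row killers of item 20195 ARE thick equal-size LOWER-SET pairs

Helper file (`--supports stmt-ValiantsHypothesis-21882`; cell valiant-natproofs, rung V4, 𝒟-side; prover seat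
val-np-p5 gen 31). Definition-free. Closes NO item; it is a NEGATIVE fact about the registered residual node of the
line `affine_lower` (registry v3, `Cruxes/ChowHitsPartitionMinorsR/Lines/affine_lower.lean`).

**The observation.** The layout with which val-np-p2 g9 refuted item 20195 (`ChowStarve.no_chow_witness`,
`ChowStarve.not_ChowHitsThinRowPartitionMinors`) — rows = ALL subsets of `Fin n` of size `≤ 2`, columns = the same
sets except that every pair inside the starved block `O = {o+1, …, 2o}` is replaced by the triple
`{c − (o+1), c' − (o+1), o}`, at height `n = 2o + 1` — has BOTH families DOWN-CLOSED (lower sets), of EQUAL size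
`1 + n + C(n,2)`, and BOTH THICK (`Σ_i |u i| = n·n`, `Σ_j |w j| ≥ n·n`). By `no_chow_witness` no product of `n + n`
affine forms hits it as soon as `3n < C(o+1, 2)`, i.e. `o ≥ 12`, `n ≥ 25` (`exists_starvedPair`).

**Consequences (all kernel-checked here).**
* The pair is neither x-star-, nor y-star-, nor BI-STAR-certifiable (`ChowNoStar.IsXStarCertifiable`,
  `ChowNoStar.IsBiStarCertifiable`: those certificates yield `h` resp. `h + h` hitting forms, arrows p714438 / p717689 /
  p720686) — so for every `h₀` the hypothesis class of the REGISTERED node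
  `ChowNoStar.Stmt.stub_thickLowerSetsChowRNoBiStar` (registry v3) has a member at some height `h ≥ h₀`
  (`noBiStar_node_nonvacuous`): the node is NOT vacuous, contrary to CONJECTURE T** of memo
  MEMO-21882-valnp5-g30.md §2 («the 2h-form bi-star design hits every equal-size lower pair, every h»), which is
  therefore FALSE (`not_biStar_hits_all_lowerPairs`); so is its rectangular form BFR, and more generally NO design with
  `h + h` affine forms closes the node (`not_lowerPairs_hit_by_two_h`). The exhaustive censuses `h ≤ 8` could not see
  this: the obstruction needs `C(o+1,2) > 3(2o+1)`.
* Quantitatively (memo REFUTATION-20195-valnp2-g9.md §2, numerics): these pairs revive only with `≈ C(o+1,2) − n ≈ n²/8`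
  generic forms; the budget of the node is `n·n − 2n`, so the node survives, but any proof of it must spend `Θ(h²)`
  forms on such pairs — the `O(h)`-form designs (x-star, bi-star, `h` generic forms) of memos g29/g30 cannot.

WHAT THIS IS NOT: not a refutation of item 21882 nor of the registered nodes (budget `h·h − 2h ≫ 2h`); nothing on
crux stmt-ValiantsHypothesis-14610 or on `VP` versus `VNP`.
-/

set_option linter.dupNamespace false

namespace Summit.ValiantsHypothesis.ValiantsHypothesis.Theorems.BarrierLever.ChowStarvedPairs

open Finset MvPolynomial
open Summit.ValiantsHypothesis.ValiantsHypothesis.Theorems.BarrierLever.ChowStarve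
  (no_chow_witness three_mul_lt_choose)
open Summit.ValiantsHypothesis.ValiantsHypothesis.Theorems.BarrierLever.ChowNoStar
  (IsXStarCertifiable IsBiStarCertifiable chowHits_of_isXStarCertifiable chowHits_of_isXStarCertifiable_swap
    chowHits_of_isBiStarCertifiable)

/-- `2·C(2o+1, 2) + (2o+1) = (2o+1)²`. -/
theorem two_mul_choose_two_add (o : ℕ) :
    2 * Nat.choose (2 * o + 1) 2 + (2 * o + 1) = (2 * o + 1) * (2 * o + 1) := by
  have h := Nat.add_one_mul_choose_eq (2 * o) 1
  rw [Nat.choose_one_right] at h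
  -- h : (2o+1) * (2o) = (2o+1).choose 2 * 2
  have h' : 2 * Nat.choose (2 * o + 1) 2 = (2 * o + 1) * (2 * o) := by
    rw [mul_comm]; exact h.symm
  rw [h']
  ring

/-- **STARVED PAIRS.** For every `o ≥ 12`, at height `n = 2o+1` there is an injective layout `(u, w)` with BOTH
ranges down-closed (lower sets), `Σ_i |u i| + n = n·n + n` … precisely `n·n < Σ_i |u i| + n ≤ Σ_j |w j| + n`, on which
EVERY product of `n + n` polynomials of total degree `≤ 1` has vanishing partition minor. (Rows: all sets of size
`≤ 2`; columns: pairs inside `{o+1,…,2o}` replaced by triples `{c−(o+1), c'−(o+1), o}`; `ChowStarve.no_chow_witness`.) -/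
theorem exists_starvedPair (o : ℕ) (ho12 : 12 ≤ o) :
    ∃ (r : ℕ) (u w : Fin r → Finset (Fin (2 * o + 1))),
      Function.Injective u ∧ Function.Injective w ∧
      IsLowerSet (Set.range u) ∧ IsLowerSet (Set.range w) ∧
      (2 * o + 1) * (2 * o + 1) < (∑ i, (u i).card) + (2 * o + 1) ∧
      (∑ i, (u i).card) ≤ (∑ j, (w j).card) ∧
      ∀ ℓ : Fin ((2 * o + 1) + (2 * o + 1)) → MvPolynomial (Fin ((2 * o + 1) + (2 * o + 1))) ℂ,
        (∀ k, (ℓ k).totalDegree ≤ 1) →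
        (Matrix.of fun i j : Fin r => coeff (∑ a ∈ u i, Finsupp.single (Fin.castAdd (2 * o + 1) a) 1 +
            ∑ c ∈ w j, Finsupp.single (Fin.natAdd (2 * o + 1) c) 1) (∏ k, ℓ k)).det = 0 := by
  classical
  set n : ℕ := 2 * o + 1 with hn
  have hoo : o + o < n := by omega
  -- the rows: all sets of size `≤ 2`
  set 𝒯 : Finset (Finset (Fin n)) := Finset.univ.filter fun U => U.card ≤ 2 with h𝒯
  set r : ℕ := 𝒯.card with hr
  let e : 𝒯 ≃ Fin r := 𝒯.equivFin
  let u : Fin r → Finset (Fin n) := fun i => (e.symm i).1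
  have hu_mem : ∀ i, (u i).card ≤ 2 := fun i => by
    have h2 : ((e.symm i : 𝒯) : Finset (Fin n)) ∈ Finset.univ.filter (fun U : Finset (Fin n) => U.card ≤ 2) :=
      (e.symm i).2
    exact (Finset.mem_filter.mp h2).2
  have hu : Function.Injective u := fun i j hij =>
    e.symm.injective (Subtype.ext hij)
  have hcov : ∀ U : Finset (Fin n), U.card ≤ 2 → ∃ i, u i = U := fun U hU =>
    ⟨e ⟨U, Finset.mem_filter.mpr ⟨Finset.mem_univ _, hU⟩⟩, by
      simp only [u, Equiv.symm_apply_apply]⟩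
  -- the columns: pairs inside `O` become triples inside `K`
  let σ : Fin n → Fin n := fun x => ⟨(x : ℕ) - (o + 1), by omega⟩
  let oK : Fin n := ⟨o, by omega⟩
  let τ : Finset (Fin n) → Finset (Fin n) := fun U =>
    if U.card = 2 ∧ ∀ x ∈ U, o < (x : ℕ) then insert oK (U.image σ) else U
  let w : Fin r → Finset (Fin n) := fun i => τ (u i)
  have hτK : ∀ U : Finset (Fin n), ∀ x ∈ insert oK (U.image σ), (x : ℕ) ≤ o := by
    intro U x hx
    rcases Finset.mem_insert.mp hx with rfl | hx
    · exact le_rfl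
    · obtain ⟨y, -, rfl⟩ := Finset.mem_image.mp hx
      show (y : ℕ) - (o + 1) ≤ o
      have := y.is_lt
      omega
  have hσinj : ∀ U : Finset (Fin n), (∀ x ∈ U, o < (x : ℕ)) → Set.InjOn σ U := by
    intro U hU x hx y hy hxy
    have e1 := congrArg Fin.val hxy
    simp only [σ] at e1
    have := hU x hx
    have := hU y hy
    exact Fin.ext (by omega)
  have hcard3 : ∀ U : Finset (Fin n), U.card = 2 → (∀ x ∈ U, o < (x : ℕ)) →
      (insert oK (U.image σ)).card = 3 := by
    intro U hU2 hU
    rw [Finset.card_insert_of_notMem, Finset.card_image_of_injOn (hσinj U hU), hU2]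
    intro hmem
    obtain ⟨y, hy, hyo⟩ := Finset.mem_image.mp hmem
    have e1 := congrArg Fin.val hyo
    simp only [σ, oK] at e1
    have := hU y hy
    have := y.is_lt
    omega
  -- `τ` fixes every set that is not a pair inside `O`, and enlarges the others
  have hτ_of_not : ∀ U : Finset (Fin n), ¬ (U.card = 2 ∧ ∀ x ∈ U, o < (x : ℕ)) → τ U = U := by
    intro U hU
    simp only [τ]
    rw [if_neg hU]
  have hτ_card : ∀ U : Finset (Fin n), U.card ≤ 2 → U.card ≤ (τ U).card := by
    intro U hU
    by_cases hc : U.card = 2 ∧ ∀ x ∈ U, o < (x : ℕ)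
    · simp only [τ]
      rw [if_pos hc, hcard3 U hc.1 hc.2]
      omega
    · rw [hτ_of_not U hc]
  -- injectivity of the columns
  have hw : Function.Injective w := by
    intro i j hij
    simp only [w, τ] at hij
    by_cases hi : (u i).card = 2 ∧ ∀ x ∈ u i, o < (x : ℕ)
    · by_cases hj : (u j).card = 2 ∧ ∀ x ∈ u j, o < (x : ℕ)
      · rw [if_pos hi, if_pos hj] at hij
        apply hu
        have hoi : oK ∉ (u i).image σ := by
          intro hmem
          obtain ⟨y, hy, hyo⟩ := Finset.mem_image.mp hmem
          have e1 := congrArg Fin.val hyo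
          simp only [σ, oK] at e1
          have := hi.2 y hy; have := y.is_lt; omega
        have hoj : oK ∉ (u j).image σ := by
          intro hmem
          obtain ⟨y, hy, hyo⟩ := Finset.mem_image.mp hmem
          have e1 := congrArg Fin.val hyo
          simp only [σ, oK] at e1
          have := hj.2 y hy; have := y.is_lt; omega
        have himg : (u i).image σ = (u j).image σ := by
          have := congrArg (fun S => S.erase oK) hij
          simpa only [Finset.erase_insert hoi, Finset.erase_insert hoj] using this
        have hrec : ∀ U V : Finset (Fin n), (∀ x ∈ U, o < (x : ℕ)) → (∀ x ∈ V, o < (x : ℕ)) →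
            U.image σ = V.image σ → U ⊆ V := by
          intro U V hU hV hUV x hx
          have hmem : σ x ∈ V.image σ := hUV ▸ Finset.mem_image_of_mem σ hx
          obtain ⟨y, hy, hyx⟩ := Finset.mem_image.mp hmem
          have e1 := congrArg Fin.val hyx
          simp only [σ] at e1
          have := hU x hx
          have := hV y hy
          have hyx' : y = x := Fin.ext (by omega)
          rw [← hyx']
          exact hy
        exact Finset.Subset.antisymm (hrec _ _ hi.2 hj.2 himg) (hrec _ _ hj.2 hi.2 himg.symm)
      · rw [if_pos hi, if_neg hj] at hij
        exfalso
        have := hcard3 (u i) hi.1 hi.2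
        rw [hij] at this
        have := hu_mem j
        omega
    · by_cases hj : (u j).card = 2 ∧ ∀ x ∈ u j, o < (x : ℕ)
      · rw [if_neg hi, if_pos hj] at hij
        exfalso
        have := hcard3 (u j) hj.1 hj.2
        rw [← hij] at this
        have := hu_mem i
        omega
      · rw [if_neg hi, if_neg hj] at hij
        exact hu hij
  -- column properties
  have hw3 : ∀ j, (w j).card ≤ 3 := by
    intro j
    simp only [w, τ]
    by_cases hc : (u j).card = 2 ∧ ∀ x ∈ u j, o < (x : ℕ)
    · rw [if_pos hc, hcard3 (u j) hc.1 hc.2]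
    · rw [if_neg hc]
      exact (hu_mem j).trans (by norm_num)
  have hwO : ∀ j, ∀ c ∈ w j, ∀ c' ∈ w j, c ≠ c' → (c : ℕ) ≤ o ∨ (c' : ℕ) ≤ o := by
    intro j c hc c' hc' hne
    simp only [w, τ] at hc hc'
    by_cases hcond : (u j).card = 2 ∧ ∀ x ∈ u j, o < (x : ℕ)
    · rw [if_pos hcond] at hc
      exact Or.inl (hτK (u j) c hc)
    · rw [if_neg hcond] at hc hc'
      rcases Nat.lt_or_ge (u j).card 2 with hlt | hge
      · exact absurd (Finset.card_le_one.mp (by omega) c hc c' hc') hne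
      · have hcard2 : (u j).card = 2 := le_antisymm (hu_mem j) hge
        have hx : ∃ x ∈ u j, (x : ℕ) ≤ o := by
          by_contra hall
          push Not at hall
          exact hcond ⟨hcard2, hall⟩
        obtain ⟨x, hxU, hxo⟩ := hx
        obtain ⟨a, b, hab, hUab⟩ := Finset.card_eq_two.mp hcard2
        rw [hUab, Finset.mem_insert, Finset.mem_singleton] at hc hc' hxU
        rcases hc with rfl | rfl <;> rcases hc' with rfl | rfl
        · exact absurd rfl hne
        · rcases hxU with rfl | rfl
          · exact Or.inl hxo
          · exact Or.inr hxo
        · rcases hxU with rfl | rfl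
          · exact Or.inr hxo
          · exact Or.inl hxo
        · exact absurd rfl hne
  have hwK : ∀ j, (w j).card = 3 → ∀ e' ∈ w j, (e' : ℕ) ≤ o := by
    intro j h3 e' he'
    simp only [w, τ] at h3 he'
    by_cases hcond : (u j).card = 2 ∧ ∀ x ∈ u j, o < (x : ℕ)
    · rw [if_pos hcond] at he'
      exact hτK (u j) e' he'
    · rw [if_neg hcond] at h3
      have := hu_mem j
      omega
  -- LOWER SETS: the rows
  have hlu : IsLowerSet (Set.range u) := by
    rintro U V hVU ⟨i, rfl⟩
    have hV : V.card ≤ 2 := (Finset.card_le_card hVU).trans (hu_mem i)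
    obtain ⟨i', hi'⟩ := hcov V hV
    exact ⟨i', hi'⟩
  -- LOWER SETS: the columns
  have hlw : IsLowerSet (Set.range w) := by
    rintro W V hVW ⟨j, rfl⟩
    -- `W = w j = τ (u j)`; either `V = W`, or `V` is a set of size `≤ 2` which `τ` fixes
    by_cases hVeq : V = τ (u j)
    · exact ⟨j, hVeq.symm⟩
    have hVss : V ⊂ τ (u j) := lt_of_le_of_ne hVW hVeq
    have hVlt : V.card < (τ (u j)).card := Finset.card_lt_card hVss
    have hV2 : V.card ≤ 2 := by
      have := hw3 j
      simp only [w] at this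
      omega
    obtain ⟨i, hi⟩ := hcov V hV2
    refine ⟨i, ?_⟩
    show τ (u i) = V
    rw [hi]
    apply hτ_of_not
    rintro ⟨hV2eq, hVO⟩
    by_cases hcond : (u j).card = 2 ∧ ∀ x ∈ u j, o < (x : ℕ)
    · -- the column is a triple inside `K`: its elements are `≤ o`, so `V` is not inside `O`
      have hWK : ∀ x ∈ τ (u j), (x : ℕ) ≤ o := by
        intro x hx
        simp only [τ] at hx
        rw [if_pos hcond] at hx
        exact hτK (u j) x hx
      obtain ⟨x, hx⟩ : V.Nonempty := by
        rw [← Finset.card_pos]; omega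
      have h1 := hVO x hx
      have h2 := hWK x (hVW hx)
      omega
    · -- the column is `u j` itself, of size `≤ 2`: a proper subset has size `< 2`
      rw [hτ_of_not (u j) hcond] at hVlt
      have := hu_mem j
      omega
  -- THICKNESS: `Σ_i |u i| ≥ 1 + 2·C(n,2) = n·n − n + 1`
  have hsum_u : (∑ i, (u i).card) = ∑ U ∈ 𝒯, U.card := by
    have h1 : (∑ i, (u i).card) = ∑ x : 𝒯, (x : Finset (Fin n)).card :=
      Fintype.sum_equiv e.symm (fun i => (u i).card) (fun x => (x : Finset (Fin n)).card) (fun i => rfl)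
    rw [h1, Finset.sum_coe_sort]
  have hsub : insert ({⟨0, by omega⟩} : Finset (Fin n)) (Finset.powersetCard 2 (Finset.univ : Finset (Fin n))) ⊆ 𝒯 := by
    intro U hU
    rw [Finset.mem_insert] at hU
    rw [h𝒯, Finset.mem_filter]
    refine ⟨Finset.mem_univ _, ?_⟩
    rcases hU with rfl | hU
    · rw [Finset.card_singleton]; omega
    · rw [(Finset.mem_powersetCard.mp hU).2]
  have hnotmem : ({⟨0, by omega⟩} : Finset (Fin n)) ∉ Finset.powersetCard 2 (Finset.univ : Finset (Fin n)) := by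
    intro hmem
    have := (Finset.mem_powersetCard.mp hmem).2
    rw [Finset.card_singleton] at this
    omega
  have hbig : 1 + 2 * Nat.choose n 2 ≤ ∑ U ∈ 𝒯, U.card := by
    calc 1 + 2 * Nat.choose n 2
        = ∑ U ∈ insert ({⟨0, by omega⟩} : Finset (Fin n)) (Finset.powersetCard 2 (Finset.univ : Finset (Fin n))),
            U.card := by
          rw [Finset.sum_insert hnotmem, Finset.card_singleton]
          congr 1
          rw [Finset.sum_const_nat (m := 2) (fun U hU => (Finset.mem_powersetCard.mp hU).2),
            Finset.card_powersetCard, Finset.card_univ, Fintype.card_fin, mul_comm]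
      _ ≤ ∑ U ∈ 𝒯, U.card := Finset.sum_le_sum_of_subset hsub
  have hthick : n * n < (∑ i, (u i).card) + n := by
    rw [hsum_u]
    have := two_mul_choose_two_add o
    rw [← hn] at this
    omega
  have hsum_w : (∑ i, (u i).card) ≤ ∑ j, (w j).card :=
    Finset.sum_le_sum fun i _ => hτ_card (u i) (hu_mem i)
  refine ⟨r, u, w, hu, hw, hlu, hlw, hthick, hsum_w, fun ℓ hℓ => ?_⟩
  exact no_chow_witness o u w hu hcov hw3 hwO hwK hoo
    (by rw [hn]; exact three_mul_lt_choose o ho12) ℓ hℓ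

/-- **The starved pairs are not hit by any `M ≤ n + n` affine forms** (padding `ChowNoStar.chowHits_mono`). -/
theorem exists_starvedPair_le (o : ℕ) (ho12 : 12 ≤ o) {M : ℕ} (hM : M ≤ (2 * o + 1) + (2 * o + 1)) :
    ∃ (r : ℕ) (u w : Fin r → Finset (Fin (2 * o + 1))),
      Function.Injective u ∧ Function.Injective w ∧
      IsLowerSet (Set.range u) ∧ IsLowerSet (Set.range w) ∧
      (2 * o + 1) * (2 * o + 1) < (∑ i, (u i).card) + (2 * o + 1) ∧
      (∑ i, (u i).card) ≤ (∑ j, (w j).card) ∧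
      ¬ ∃ ℓ : Fin M → MvPolynomial (Fin ((2 * o + 1) + (2 * o + 1))) ℂ,
        (∀ k, (ℓ k).totalDegree ≤ 1) ∧
        (Matrix.of fun i j : Fin r => coeff (∑ a ∈ u i, Finsupp.single (Fin.castAdd (2 * o + 1) a) 1 +
            ∑ c ∈ w j, Finsupp.single (Fin.natAdd (2 * o + 1) c) 1) (∏ k, ℓ k)).det ≠ 0 := by
  obtain ⟨r, u, w, hu, hw, hlu, hlw, hthick, hsum, hdead⟩ := exists_starvedPair o ho12
  refine ⟨r, u, w, hu, hw, hlu, hlw, hthick, hsum, fun hhit => ?_⟩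
  obtain ⟨ℓ, hℓ, hdet⟩ := ChowNoStar.chowHits_mono hM u w hhit
  exact hdet (hdead ℓ hℓ)

/-- **The REGISTERED residual node is NOT vacuous.** For every `h₀` there are a height `h ≥ h₀` and an injective
LOWER-SET pair `(v, w')` satisfying EVERY hypothesis of `ChowNoStar.Stmt.stub_thickLowerSetsChowRNoBiStar`
(registry v3 of line `affine_lower`): both thick (`h·h < ‖v‖ + 2h`, `h·h < ‖w'‖ + 2h`, indeed `+ h` suffices),
neither x-star- nor y-star- nor bi-star-certifiable — and moreover hit by NO product of `h + h` affine forms.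
(`h = 2·max 12 h₀ + 1`; the starved pair.) -/
theorem noBiStar_node_nonvacuous (h₀ : ℕ) :
    ∃ h : ℕ, h₀ ≤ h ∧ ∃ (r : ℕ) (v w' : Fin r → Finset (Fin h)),
      Function.Injective v ∧ Function.Injective w' ∧
      IsLowerSet (Set.range v) ∧ IsLowerSet (Set.range w') ∧
      h * h < (∑ i, (v i).card) + h ∧ h * h < (∑ j, (w' j).card) + h ∧
      h * h < (∑ i, (v i).card) + 2 * h ∧ h * h < (∑ j, (w' j).card) + 2 * h ∧
      ¬ IsXStarCertifiable v w' ∧ ¬ IsXStarCertifiable w' v ∧ ¬ IsBiStarCertifiable v w' ∧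
      ∀ ℓ : Fin (h + h) → MvPolynomial (Fin (h + h)) ℂ, (∀ k, (ℓ k).totalDegree ≤ 1) →
        (Matrix.of fun i j : Fin r => coeff (∑ a ∈ v i, Finsupp.single (Fin.castAdd h a) 1 +
            ∑ c ∈ w' j, Finsupp.single (Fin.natAdd h c) 1) (∏ k, ℓ k)).det = 0 := by
  set o : ℕ := max 12 h₀ with ho
  have ho12 : 12 ≤ o := le_max_left _ _
  have hoh₀ : h₀ ≤ o := le_max_right _ _
  obtain ⟨r, u, w, hu, hw, hlu, hlw, hthick, hsum, hdead⟩ := exists_starvedPair o ho12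
  refine ⟨2 * o + 1, by omega, r, u, w, hu, hw, hlu, hlw, hthick, by omega, by omega, by omega,
    fun hX => ?_, fun hY => ?_, fun hB => ?_, hdead⟩
  · obtain ⟨ℓ, hℓ, hdet⟩ := chowHits_of_isXStarCertifiable (M := (2 * o + 1) + (2 * o + 1)) (by omega) u w hX
    exact hdet (hdead ℓ hℓ)
  · obtain ⟨ℓ, hℓ, hdet⟩ :=
      chowHits_of_isXStarCertifiable_swap (M := (2 * o + 1) + (2 * o + 1)) (by omega) u w hY
    exact hdet (hdead ℓ hℓ)
  · obtain ⟨ℓ, hℓ, hdet⟩ := chowHits_of_isBiStarCertifiable (M := (2 * o + 1) + (2 * o + 1)) le_rfl u w hB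
    exact hdet (hdead ℓ hℓ)

/-- **CONJECTURE T** (memo MEMO-21882-valnp5-g30.md §2: «the `2h`-form bi-star design hits every equal-size lower pair,
every `h`») IS FALSE**: for every threshold `h₀` some injective lower-set pair at a height `h ≥ h₀` is not
bi-star-certifiable. -/
theorem not_biStar_hits_all_lowerPairs :
    ¬ ∃ h₀ : ℕ, ∀ h : ℕ, h₀ ≤ h → ∀ (r : ℕ) (v w' : Fin r → Finset (Fin h)),
      Function.Injective v → Function.Injective w' →
      IsLowerSet (Set.range v) → IsLowerSet (Set.range w') → IsBiStarCertifiable v w' := by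
  rintro ⟨h₀, H⟩
  obtain ⟨h, hh, r, v, w', hv, hw', hlv, hlw', -, -, -, -, -, -, hB, -⟩ := noBiStar_node_nonvacuous h₀
  exact hB (H h hh r v w' hv hw' hlv hlw')

/-- **No `h + h`-form design closes the lower-set node**: it is false that all injective lower-set pairs at all
large heights are hit by products of `h + h` affine forms (so the `2h` lower-set analogue of the refuted item 20172 is
false as well; the registered budget is `h·h − 2h`). -/
theorem not_lowerPairs_hit_by_two_h :
    ¬ ∃ h₀ : ℕ, ∀ h : ℕ, h₀ ≤ h → ∀ (r : ℕ) (v w' : Fin r → Finset (Fin h)),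
      Function.Injective v → Function.Injective w' →
      IsLowerSet (Set.range v) → IsLowerSet (Set.range w') →
      ∃ ℓ : Fin (h + h) → MvPolynomial (Fin (h + h)) ℂ, (∀ k, (ℓ k).totalDegree ≤ 1) ∧
        (Matrix.of fun i j : Fin r => coeff (∑ a ∈ v i, Finsupp.single (Fin.castAdd h a) 1 +
            ∑ c ∈ w' j, Finsupp.single (Fin.natAdd h c) 1) (∏ k, ℓ k)).det ≠ 0 := by
  rintro ⟨h₀, H⟩
  obtain ⟨h, hh, r, v, w', hv, hw', hlv, hlw', -, -, -, -, -, -, -, hdead⟩ := noBiStar_node_nonvacuous h₀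
  obtain ⟨ℓ, hℓ, hdet⟩ := H h hh r v w' hv hw' hlv hlw'
  exact hdet (hdead ℓ hℓ)

end Summit.ValiantsHypothesis.ValiantsHypothesis.Theorems.BarrierLever.ChowStarvedPairs
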